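import Literature.NumberTheory.Rogawski1990.CMLocalAPacketMembers             -- ★ `KeysCaseTwoLabels`, `Gqs`, `keysLabels_unique` (+ ★ NF1 `KeysCaseTwo`, `IrrClass.IsSquareIntegrable`)
import Literature.NumberTheory.Rogawski1990.SemilocalQuadraticCharExtension    -- ★ `isQuadraticCharExtension_semilocalComponent_of_baseChange_eq`
import Literature.NumberTheory.Automorphic.TorusCharacterLocalComponents       -- ★ `torusLocalComponent`, `continuous_semilocalComponent`, `continuous_torusLocalComponent`
import Literature.NumberTheory.Rogawski1990.OneDimAutRepH                      -- ★ `OneDimAutRepH` (the `ξ = (η, ψ)` of the (D-b)ᵀ binders)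
import Literature.NumberTheory.Automorphic.LocalUnitaryGroupCongrInner         -- ★ K5 `exists_cmDatumLocalCongr_eq_apply_conj` (congruence independence)
import Literature.NumberTheory.Automorphic.IrreducibleClassesComapInner        -- ★ `IrrClass.comap_symm_eq_comap_symm_of_forall_eq_conj`
import Summits.HodgeConjecture.HodgeConjecture.Theorems.F0P3N3ConeClosed       -- ★ `keysCaseTwo_holds` (Keys' case (2), HYPOTHESIS-FREE)
import HarnessLib

/-!
# Crux `H413`, line LH10 «(D-b)ᵀ» (books #76 Test edition) — organ (LRᴸ): KEYS-LABEL RIGIDITY ACROSS HAAR MEASURES AND FORM CONGRUENCES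

Cell `hodgecm-mathlib` (D-0151), FLOOR 0, crux item H413 = `stmt-HodgeConjecture-24833`; squad F0∕P3c line LH10 (pay-down of the print letter (D-b)ᵀ
★ `GelbartRogawski1991.piSCompletion_isThetaTypeAtCMTest`), seat LH10-p02 (g0), 2026-09-02 (DEFAULT organ, SEATPLAN-GO500 v1 §0∕§5).  THEOREMS ONLY (no `def`,
no named fact, no `sorry`, no instance∕notation); `--supports stmt-HodgeConjecture-24833`.  HONEST LABEL: HC_CM is proved only modulo the printed citations until
rung 0 closes; nothing here proves a letter.

WHY.  The Keys labels `(π², πⁿ)` of the reducible unitary principal series `i_G(χ_ξ)` of `U(Φ₃)(L⁺_v)` at a non-split place [Rogawski1990 §12.2 (2): «`i_G(χ)` has a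
unique square-integrable constituent … denote it by `π²(ξ)` and let `πⁿ(ξ)` be the remaining constituent»] are pinned in the tree PER HAAR MEASURE `μZ` on
`U(Φ₃)(L⁺_v) ⧸ Z` (★ `KeysCaseTwo.labels_unique`, ★ `keysLabels_unique`: both pairs must be labelled by square-integrability for the SAME `μZ`).  The letter (D-b)ᵀ
quantifies its own `[MeasurableSpace] [BorelSpace] (μZ) [IsHaarMeasure]`, its own form congruence `ᵗT̄·H_v·T = a·Φ₃` and its own labelled pair `(π², πⁿ)`,
whereas every record-side statement (the SHAPEᵀ of the packet of record, the Q-CM test package) speaks at the record's `(T_v, μZ_rec v, keys ξ v)`.  This file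
closes that gap ONCE, hypothesis-free:

* §1 (generic) `IrrClass.isSquareIntegrable_mono_measure` — square-integrability mod centre passes to a smaller measure (`ν ≤ μ`); `isHaarMeasure_add` — the sum of
  two Haar measures is a Haar measure.
* §2 (Keys data, over ★ NF1 `KeysCaseTwo` as a hypothesis) `keysLabels_isSquareIntegrable_of_isHaarMeasure` — for ANY two Haar measures `μZ, μZ′` (on the same Borel
  σ-algebra): `KeysCaseTwoLabels … π² πⁿ → ¬ πⁿ.IsSquareIntegrable μZ → (π².IsSquareIntegrable μZ′ ∧ ¬ πⁿ.IsSquareIntegrable μZ′)`.  Proof: Keys' case (2) at the Haar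
  measure `μZ + μZ′` and monotonicity — NO Haar uniqueness, NO second countability is used.  Variants `…_of_isSquareIntegrable` (pinned by `π²` instead) and
  `keysLabels_unique_of_isHaarMeasure` (two pairs pinned at DIFFERENT Haar measures coincide).
* §3 (the (D-b)ᵀ characters `(μω_v, η_v, ψ_v)`, HYPOTHESIS-FREE over ★ `keysCaseTwo_holds`) `keysLabelsCM_isSquareIntegrable_of_isHaarMeasure`,
  `keysLabelsCM_unique_of_isHaarMeasure`.
* §4 (+ ★ K5 congruence independence) `comap_keysLabelCM_eq` — for ANY two binder tuples `(T, μZ, π², πⁿ)`, `(T′, μZ′, π²′, πⁿ′)` of (D-b)ᵀ at the same `(ξ, v)`: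
  `IrrClass.comap (cmDatumLocalCongr L v T ha h).symm πⁿ = IrrClass.comap (cmDatumLocalCongr L v T′ ha′ h′).symm πⁿ′` — «the class `πⁿ(ξ_v) ∘ e` of `U(H)(L⁺_v)`
  is intrinsic», so a clause `CharIdentityAtTest ⟨πⁿ ∘ e, some πs⟩ …` ∕ `ThetaTypeAtCM … (πⁿ ∘ e)` moves between binder tuples by `rw`; same for `π²`.

## References
* [Rogawski1990] J. Rogawski, Ann. of Math. Stud. 123 (1990): §12.2 (2) pp. 173–174 (Keys' case (2), the labels `π²(ξ)`, `πⁿ(ξ)`); §14.2 p. 234; §3.5 Lemma 3.5.3 (a).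
* [Keys1984] D. Keys, Compositio Math. 51 (1984), §7 Thm. p. 126.
* [BushnellHenniart2006] C. Bushnell, G. Henniart, Grundlehren 335, §1.1 (classes are conjugation-invariant), §10.1 (square-integrability mod centre).
-/

set_option autoImplicit false
-- the mandated namespace repeats `HodgeConjecture.HodgeConjecture`, as in every `Theorems/*.lean` of this sub-problem
set_option linter.dupNamespace false

noncomputable section

open NumberField IsDedekindDomain MeasureTheory
open scoped Matrix ENNReal

open Literature.NumberTheory Literature.NumberTheory.Automorphic Literature.NumberTheory.Automorphic.UnitaryGroup
open Literature.NumberTheory.GaloisRepresentations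
open Literature.NumberTheory.Rogawski1990

namespace Summit.HodgeConjecture.HodgeConjecture.Cruxes.H413.F0P3cDbTKeysLabelRigidity

/-! ## §1 Generic: square-integrability mod centre under a change of measure; sums of Haar measures -/

section Generic

/-- **Square-integrability modulo the centre passes to a smaller measure**: if `ν ≤ μ` on `G ⧸ Z(G)` and the class `c` is square-integrable for `μ`
(some representative has every smooth matrix coefficient dominated by an `L²(μ)` function), then it is square-integrable for `ν` (the same dominating
function is `L²(ν)`, ★ `MemLp.mono_measure`). [cite: BushnellHenniart2006, §10.1] -/
theorem isSquareIntegrable_mono_measure {G : Type} [Group G] [TopologicalSpace G] [SeparatelyContinuousMul G]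
    [MeasurableSpace (G ⧸ Subgroup.center G)] {μ ν : Measure (G ⧸ Subgroup.center G)} (hle : ν ≤ μ) {c : IrrClass G}
    (h : c.IsSquareIntegrable μ) : c.IsSquareIntegrable ν := by
  obtain ⟨r, hr, hsq⟩ := h
  refine ⟨r, hr, fun φ hφ w => ?_⟩
  obtain ⟨f, hf, hdom⟩ := hsq φ hφ w
  exact ⟨f, hf.mono_measure hle, hdom⟩

/-- **The sum of two Haar measures is a Haar measure** (finite on compacts, left-invariant, positive on non-empty opens) — on any topological group whose
left translations are measurable. [cite: BushnellHenniart2006, §10.1] -/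
theorem isHaarMeasure_add {Q : Type*} [Group Q] [TopologicalSpace Q] [MeasurableSpace Q] [MeasurableMul Q]
    (μ ν : Measure Q) [μ.IsHaarMeasure] [ν.IsHaarMeasure] : (μ + ν).IsHaarMeasure where
  lt_top_of_isCompact := fun K hK => by
    rw [Measure.add_apply]
    exact ENNReal.add_lt_top.2 ⟨hK.measure_lt_top, hK.measure_lt_top⟩
  map_mul_left_eq_self := fun g => by
    rw [Measure.map_add _ _ (measurable_const_mul g), map_mul_left_eq_self, map_mul_left_eq_self]
  open_pos := fun U hU hne => by
    rw [Measure.add_apply]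
    exact fun h0 => hU.measure_ne_zero μ hne (add_eq_zero.1 h0).1

end Generic

/-! ## §2 Keys data at a non-split place: the labels do not depend on the Haar measure -/

section Keys

variable {L : Type} [Field L] [NumberField L] [IsCMField L]

set_option synthInstance.maxHeartbeats 400000 in
set_option maxHeartbeats 1600000 in
/-- **MEASURE-INDEPENDENCE OF THE KEYS LABELS (pinned by `πⁿ`)**, over ★ NF1 `KeysCaseTwo` as a hypothesis: at a non-split finite place `v`, for Keys' case-(2) data
`(μ, η₁, η₂)` (`μ` quadratic on `σ`-fixed units, all three continuous) and ANY two Haar measures `μZ, μZ′` on `U(Φ₃)(L⁺_v) ⧸ Z`, a labelled pair `(π², πⁿ)` of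
`JH(i_G(χ_ξ))` whose `πⁿ` is not square-integrable for `μZ` has `π²` square-integrable and `πⁿ` not square-integrable for `μZ′`.  Proof: Keys' case (2) at the Haar
measure `μZ + μZ′` gives a pair whose square-integrable member is square-integrable for both `μZ` and `μZ′` (§1); it is `π²`; then Keys' case (2) at `μZ′` pins `πⁿ`.
[cite: Rogawski1990, §12.2 (2) pp. 173–174] [cite: Keys1984, §7 Thm. p. 126] -/
theorem keysLabels_isSquareIntegrable_of_isHaarMeasure (hK : KeysCaseTwo L) {v : HeightOneSpectrum (𝓞 ↥(maximalRealSubfield L))}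
    (hns : ∀ w : PlacesOver L v, IsCMField.complexConj L • w.1 = w.1) {μ : (LocalRing L v)ˣ →* ℂˣ}
    {η₁ η₂ : ↥(normOneUnits (conjLocal L (IsCMField.complexConj L) v)) →* ℂˣ}
    (hμ : IsQuadraticCharExtension (conjLocal L (IsCMField.complexConj L) v) μ) (hμc : Continuous fun x => ((μ x : ℂˣ) : ℂ))
    (h1c : Continuous fun x => ((η₁ x : ℂˣ) : ℂ)) (h2c : Continuous fun x => ((η₂ x : ℂˣ) : ℂ))
    [MeasurableSpace (Gqs L v ⧸ Subgroup.center (Gqs L v))] [BorelSpace (Gqs L v ⧸ Subgroup.center (Gqs L v))]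
    (μZ μZ' : Measure (Gqs L v ⧸ Subgroup.center (Gqs L v))) [μZ.IsHaarMeasure] [μZ'.IsHaarMeasure]
    {π2 πn : IrrClass (Gqs L v)} (hKL : KeysCaseTwoLabels L v μ η₁ η₂ π2 πn) (hn : ¬ πn.IsSquareIntegrable μZ) :
    π2.IsSquareIntegrable μZ' ∧ ¬ πn.IsSquareIntegrable μZ' := by
  haveI : (μZ + μZ').IsHaarMeasure := isHaarMeasure_add μZ μZ'
  obtain ⟨πs₂, πn₂, -, hJH₂, hs₂, -⟩ := hK v hns μ η₁ η₂ hμ hμc h1c h2c (μZ + μZ')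
  have hs₂Z : πs₂.IsSquareIntegrable μZ := isSquareIntegrable_mono_measure (Measure.le_add_right le_rfl) hs₂
  have hs₂Z' : πs₂.IsSquareIntegrable μZ' := isSquareIntegrable_mono_measure (Measure.le_add_left le_rfl) hs₂
  -- `πⁿ ∈ {πn₂, πs₂}` and `πⁿ ≠ πs₂` (not square-integrable for `μZ`), so `π² = πs₂`
  have hπn : πn = πn₂ := by
    rcases (hJH₂ πn).1 ((hKL.2 πn).2 (Or.inl rfl)) with h | h
    · exact h
    · rw [h] at hn
      exact absurd hs₂Z hn
  have hπ2 : π2 = πs₂ := by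
    rcases (hJH₂ π2).1 ((hKL.2 π2).2 (Or.inr rfl)) with h | h
    · exact absurd (h.trans hπn.symm) hKL.1
    · exact h
  have hsZ' : π2.IsSquareIntegrable μZ' := by
    rw [hπ2]
    exact hs₂Z'
  refine ⟨hsZ', fun hnZ' => ?_⟩
  -- Keys' case (2) at `μZ′`: the non-square-integrable member is `πⁿ`
  obtain ⟨πs₃, πn₃, -, hJH₃, -, hn₃⟩ := hK v hns μ η₁ η₂ hμ hμc h1c h2c μZ'
  rcases (hJH₃ πn).1 ((hKL.2 πn).2 (Or.inl rfl)) with h | h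
  · rw [h] at hnZ'
    exact hn₃ hnZ'
  · rcases (hJH₃ π2).1 ((hKL.2 π2).2 (Or.inr rfl)) with h2 | h2
    · rw [h2] at hsZ'
      exact hn₃ hsZ'
    · exact hKL.1 (h2.trans h.symm)

set_option synthInstance.maxHeartbeats 400000 in
set_option maxHeartbeats 1600000 in
/-- **The same, pinned by `π²`**: if `π²` IS square-integrable for one Haar measure `μZ`, then for any Haar measure `μZ′` the labels are the expected ones
(`π²` square-integrable, `πⁿ` not). [cite: Rogawski1990, §12.2 (2) pp. 173–174] [cite: Keys1984, §7 Thm. p. 126] -/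
theorem keysLabels_isSquareIntegrable_of_isSquareIntegrable (hK : KeysCaseTwo L) {v : HeightOneSpectrum (𝓞 ↥(maximalRealSubfield L))}
    (hns : ∀ w : PlacesOver L v, IsCMField.complexConj L • w.1 = w.1) {μ : (LocalRing L v)ˣ →* ℂˣ}
    {η₁ η₂ : ↥(normOneUnits (conjLocal L (IsCMField.complexConj L) v)) →* ℂˣ}
    (hμ : IsQuadraticCharExtension (conjLocal L (IsCMField.complexConj L) v) μ) (hμc : Continuous fun x => ((μ x : ℂˣ) : ℂ))
    (h1c : Continuous fun x => ((η₁ x : ℂˣ) : ℂ)) (h2c : Continuous fun x => ((η₂ x : ℂˣ) : ℂ))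
    [MeasurableSpace (Gqs L v ⧸ Subgroup.center (Gqs L v))] [BorelSpace (Gqs L v ⧸ Subgroup.center (Gqs L v))]
    (μZ μZ' : Measure (Gqs L v ⧸ Subgroup.center (Gqs L v))) [μZ.IsHaarMeasure] [μZ'.IsHaarMeasure]
    {π2 πn : IrrClass (Gqs L v)} (hKL : KeysCaseTwoLabels L v μ η₁ η₂ π2 πn) (hs : π2.IsSquareIntegrable μZ) :
    π2.IsSquareIntegrable μZ' ∧ ¬ πn.IsSquareIntegrable μZ' := by
  refine keysLabels_isSquareIntegrable_of_isHaarMeasure hK hns hμ hμc h1c h2c μZ μZ' hKL fun hnZ => ?_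
  -- at `μZ`: the non-square-integrable member of Keys' pair is one of `π², πⁿ`; both are square-integrable — contradiction
  obtain ⟨πs₁, πn₁, -, hJH₁, -, hn₁⟩ := hK v hns μ η₁ η₂ hμ hμc h1c h2c μZ
  rcases (hKL.2 πn₁).1 ((hJH₁ πn₁).2 (Or.inl rfl)) with h | h
  · rw [h] at hn₁
    exact hn₁ hnZ
  · rw [h] at hn₁
    exact hn₁ hs

set_option synthInstance.maxHeartbeats 400000 in
set_option maxHeartbeats 1600000 in
/-- **Two labelled pairs pinned at DIFFERENT Haar measures coincide**: `KeysCaseTwoLabels … π² πⁿ`, `KeysCaseTwoLabels … π²′ πⁿ′`, `πⁿ` not square-integrable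
for `μZ`, `πⁿ′` not square-integrable for `μZ′` ⇒ `π²′ = π²` and `πⁿ′ = πⁿ` (★ `keysLabels_unique` after transport to `μZ′`).
[cite: Rogawski1990, §12.2 (2) pp. 173–174] [cite: Keys1984, §7 Thm. p. 126] -/
theorem keysLabels_unique_of_isHaarMeasure (hK : KeysCaseTwo L) {v : HeightOneSpectrum (𝓞 ↥(maximalRealSubfield L))}
    (hns : ∀ w : PlacesOver L v, IsCMField.complexConj L • w.1 = w.1) {μ : (LocalRing L v)ˣ →* ℂˣ}
    {η₁ η₂ : ↥(normOneUnits (conjLocal L (IsCMField.complexConj L) v)) →* ℂˣ}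
    (hμ : IsQuadraticCharExtension (conjLocal L (IsCMField.complexConj L) v) μ) (hμc : Continuous fun x => ((μ x : ℂˣ) : ℂ))
    (h1c : Continuous fun x => ((η₁ x : ℂˣ) : ℂ)) (h2c : Continuous fun x => ((η₂ x : ℂˣ) : ℂ))
    [MeasurableSpace (Gqs L v ⧸ Subgroup.center (Gqs L v))] [BorelSpace (Gqs L v ⧸ Subgroup.center (Gqs L v))]
    (μZ μZ' : Measure (Gqs L v ⧸ Subgroup.center (Gqs L v))) [μZ.IsHaarMeasure] [μZ'.IsHaarMeasure]
    {π2 πn π2' πn' : IrrClass (Gqs L v)} (hKL : KeysCaseTwoLabels L v μ η₁ η₂ π2 πn) (hKL' : KeysCaseTwoLabels L v μ η₁ η₂ π2' πn')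
    (hn : ¬ πn.IsSquareIntegrable μZ) (hn' : ¬ πn'.IsSquareIntegrable μZ') : π2' = π2 ∧ πn' = πn := by
  obtain ⟨hs, hnZ'⟩ := keysLabels_isSquareIntegrable_of_isHaarMeasure hK hns hμ hμc h1c h2c μZ μZ' hKL hn
  obtain ⟨hs', -⟩ := keysLabels_isSquareIntegrable_of_isHaarMeasure hK hns hμ hμc h1c h2c μZ' μZ' hKL' hn'
  exact keysLabels_unique hKL hKL' hs hnZ' hs' hn'

end Keys

/-! ## §3 The (D-b)ᵀ characters `(μω_v, η_v, ψ_v)`: hypothesis-free over ★ `keysCaseTwo_holds` -/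

section CM

variable {L : Type} [Field L] [NumberField L] [IsCMField L]

set_option synthInstance.maxHeartbeats 400000 in
set_option maxHeartbeats 1600000 in
/-- **MEASURE-INDEPENDENCE OF THE KEYS LABELS AT THE (D-b)ᵀ DATA, HYPOTHESIS-FREE**: for Rogawski's `μω` (`μω|_{𝕀_{L⁺}} = ω_{L/L⁺}`, whence `μω_v` is quadratic on
`σ`-fixed units, ★ `isQuadraticCharExtension_semilocalComponent_of_baseChange_eq`) and a one-dimensional `ξ = (η, ψ)`, at a non-split `v` and for ANY two Haar
measures `μZ, μZ′` on `U(Φ₃)(L⁺_v) ⧸ Z`: a pair `(π², πⁿ)` with `KeysCaseTwoLabels L v μω_v η_v ψ_v π² πⁿ` and `πⁿ` not square-integrable for `μZ` has `π²`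
square-integrable and `πⁿ` not square-integrable for `μZ′` (§2 at ★ `keysCaseTwo_holds L`). [cite: Rogawski1990, §12.2 (2) pp. 173–174] [cite: Keys1984, §7 Thm. p. 126] -/
theorem keysLabelsCM_isSquareIntegrable_of_isHaarMeasure (μω : HeckeCharacter L)
    (hμω : ∀ x : Literature.NumberTheory.GaloisRepresentations.ideleGroup ↥(maximalRealSubfield L), μω (AdeleRing.ideleBaseChange ↥(maximalRealSubfield L) L x) = quadraticHeckeCharCM L x)
    (ξ : OneDimAutRepH L) {v : HeightOneSpectrum (𝓞 ↥(maximalRealSubfield L))}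
    (hns : ∀ w : PlacesOver L v, IsCMField.complexConj L • w.1 = w.1)
    [MeasurableSpace (Gqs L v ⧸ Subgroup.center (Gqs L v))] [BorelSpace (Gqs L v ⧸ Subgroup.center (Gqs L v))]
    (μZ μZ' : Measure (Gqs L v ⧸ Subgroup.center (Gqs L v))) [μZ.IsHaarMeasure] [μZ'.IsHaarMeasure]
    {π2 πn : IrrClass (Gqs L v)}
    (hKL : KeysCaseTwoLabels L v (μω.semilocalComponent L v) (torusLocalComponent L (IsCMField.complexConj L) v ξ.η)
      (torusLocalComponent L (IsCMField.complexConj L) v ξ.ψ) π2 πn)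
    (hn : ¬ πn.IsSquareIntegrable μZ) : π2.IsSquareIntegrable μZ' ∧ ¬ πn.IsSquareIntegrable μZ' :=
  keysLabels_isSquareIntegrable_of_isHaarMeasure (F0P3N3ConeClosed.keysCaseTwo_holds L) hns
    (isQuadraticCharExtension_semilocalComponent_of_baseChange_eq μω hμω v) (Units.continuous_val.comp (continuous_semilocalComponent L μω))
    (continuous_torusLocalComponent L (IsCMField.complexConj L) ξ.η) (continuous_torusLocalComponent L (IsCMField.complexConj L) ξ.ψ) μZ μZ' hKL hn

set_option synthInstance.maxHeartbeats 400000 in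
set_option maxHeartbeats 1600000 in
/-- **The same, pinned by `π²`** (a record-side pair with `π²` square-integrable for the record's Haar measure keeps its labels for any other Haar measure).
[cite: Rogawski1990, §12.2 (2) pp. 173–174] [cite: Keys1984, §7 Thm. p. 126] -/
theorem keysLabelsCM_isSquareIntegrable_of_isSquareIntegrable (μω : HeckeCharacter L)
    (hμω : ∀ x : Literature.NumberTheory.GaloisRepresentations.ideleGroup ↥(maximalRealSubfield L), μω (AdeleRing.ideleBaseChange ↥(maximalRealSubfield L) L x) = quadraticHeckeCharCM L x)
    (ξ : OneDimAutRepH L) {v : HeightOneSpectrum (𝓞 ↥(maximalRealSubfield L))}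
    (hns : ∀ w : PlacesOver L v, IsCMField.complexConj L • w.1 = w.1)
    [MeasurableSpace (Gqs L v ⧸ Subgroup.center (Gqs L v))] [BorelSpace (Gqs L v ⧸ Subgroup.center (Gqs L v))]
    (μZ μZ' : Measure (Gqs L v ⧸ Subgroup.center (Gqs L v))) [μZ.IsHaarMeasure] [μZ'.IsHaarMeasure]
    {π2 πn : IrrClass (Gqs L v)}
    (hKL : KeysCaseTwoLabels L v (μω.semilocalComponent L v) (torusLocalComponent L (IsCMField.complexConj L) v ξ.η)
      (torusLocalComponent L (IsCMField.complexConj L) v ξ.ψ) π2 πn)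
    (hs : π2.IsSquareIntegrable μZ) : π2.IsSquareIntegrable μZ' ∧ ¬ πn.IsSquareIntegrable μZ' :=
  keysLabels_isSquareIntegrable_of_isSquareIntegrable (F0P3N3ConeClosed.keysCaseTwo_holds L) hns
    (isQuadraticCharExtension_semilocalComponent_of_baseChange_eq μω hμω v) (Units.continuous_val.comp (continuous_semilocalComponent L μω))
    (continuous_torusLocalComponent L (IsCMField.complexConj L) ξ.η) (continuous_torusLocalComponent L (IsCMField.complexConj L) ξ.ψ) μZ μZ' hKL hs

set_option synthInstance.maxHeartbeats 400000 in
set_option maxHeartbeats 1600000 in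
/-- **Two (D-b)ᵀ-labelled pairs pinned at DIFFERENT Haar measures coincide, hypothesis-free** (`π²′ = π²`, `πⁿ′ = πⁿ`).
[cite: Rogawski1990, §12.2 (2) pp. 173–174] [cite: Keys1984, §7 Thm. p. 126] -/
theorem keysLabelsCM_unique_of_isHaarMeasure (μω : HeckeCharacter L)
    (hμω : ∀ x : Literature.NumberTheory.GaloisRepresentations.ideleGroup ↥(maximalRealSubfield L), μω (AdeleRing.ideleBaseChange ↥(maximalRealSubfield L) L x) = quadraticHeckeCharCM L x)
    (ξ : OneDimAutRepH L) {v : HeightOneSpectrum (𝓞 ↥(maximalRealSubfield L))}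
    (hns : ∀ w : PlacesOver L v, IsCMField.complexConj L • w.1 = w.1)
    [MeasurableSpace (Gqs L v ⧸ Subgroup.center (Gqs L v))] [BorelSpace (Gqs L v ⧸ Subgroup.center (Gqs L v))]
    (μZ μZ' : Measure (Gqs L v ⧸ Subgroup.center (Gqs L v))) [μZ.IsHaarMeasure] [μZ'.IsHaarMeasure]
    {π2 πn π2' πn' : IrrClass (Gqs L v)}
    (hKL : KeysCaseTwoLabels L v (μω.semilocalComponent L v) (torusLocalComponent L (IsCMField.complexConj L) v ξ.η)
      (torusLocalComponent L (IsCMField.complexConj L) v ξ.ψ) π2 πn)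
    (hKL' : KeysCaseTwoLabels L v (μω.semilocalComponent L v) (torusLocalComponent L (IsCMField.complexConj L) v ξ.η)
      (torusLocalComponent L (IsCMField.complexConj L) v ξ.ψ) π2' πn')
    (hn : ¬ πn.IsSquareIntegrable μZ) (hn' : ¬ πn'.IsSquareIntegrable μZ') : π2' = π2 ∧ πn' = πn :=
  keysLabels_unique_of_isHaarMeasure (F0P3N3ConeClosed.keysCaseTwo_holds L) hns
    (isQuadraticCharExtension_semilocalComponent_of_baseChange_eq μω hμω v) (Units.continuous_val.comp (continuous_semilocalComponent L μω))
    (continuous_torusLocalComponent L (IsCMField.complexConj L) ξ.η) (continuous_torusLocalComponent L (IsCMField.complexConj L) ξ.ψ) μZ μZ' hKL hKL' hn hn'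

end CM

/-! ## §4 «`πⁿ(ξ_v) ∘ e` is intrinsic»: rigidity of the transported classes across binder tuples `(T, μZ, π², πⁿ)` -/

section Transport

variable {L : Type} [Field L] [NumberField L] [IsCMField L] {H : Matrix (Fin 3) (Fin 3) L}

set_option synthInstance.maxHeartbeats 400000 in
set_option maxHeartbeats 1600000 in
/-- **THE TRANSPORTED KEYS LABEL `πⁿ(ξ_v) ∘ e ∈ Irr(U(H)(L⁺_v))` IS INTRINSIC** — independent of the form congruence `ᵗT̄·H_v·T = a·Φ₃` (two congruences differ by an
inner automorphism of `U(Φ₃)(L⁺_v)`, ★ K5 `exists_cmDatumLocalCongr_eq_apply_conj`, and classes are conjugation-invariant, ★ `IrrClass.comap_symm_eq_comap_symm_of_forall_eq_conj`),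
of the Haar measure used to label the pair (§3) and of the labelled pair itself: for any two (D-b)ᵀ binder tuples at the same `(ξ, v)`,
`πⁿ ∘ e_T = πⁿ′ ∘ e_{T′}`.  [cite: Rogawski1990, §12.2 (2) pp. 173–174; §14.2 p. 234] [cite: BushnellHenniart2006, §1.1] -/
theorem comap_keysLabelCM_eq (hH : (H.map (cmConjRingHom L))ᵀ = H) (μω : HeckeCharacter L)
    (hμω : ∀ x : Literature.NumberTheory.GaloisRepresentations.ideleGroup ↥(maximalRealSubfield L), μω (AdeleRing.ideleBaseChange ↥(maximalRealSubfield L) L x) = quadraticHeckeCharCM L x)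
    (ξ : OneDimAutRepH L) {v : HeightOneSpectrum (𝓞 ↥(maximalRealSubfield L))}
    (hns : ∀ w : PlacesOver L v, IsCMField.complexConj L • w.1 = w.1)
    (T T' : GL (Fin 3) (LocalRing L v)) {a a' : LocalRing L v} (ha : IsUnit a) (ha' : IsUnit a')
    (h : formCongr (conjLocal L (IsCMField.complexConj L) v) T (H.map (algebraMap L (LocalRing L v))) =
      a • (Matrix.of fun i j : Fin 3 => if i.val + j.val + 1 = 3 then (1 : L) else 0).map (algebraMap L (LocalRing L v)))
    (h' : formCongr (conjLocal L (IsCMField.complexConj L) v) T' (H.map (algebraMap L (LocalRing L v))) =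
      a' • (Matrix.of fun i j : Fin 3 => if i.val + j.val + 1 = 3 then (1 : L) else 0).map (algebraMap L (LocalRing L v)))
    [MeasurableSpace (Gqs L v ⧸ Subgroup.center (Gqs L v))] [BorelSpace (Gqs L v ⧸ Subgroup.center (Gqs L v))]
    (μZ μZ' : Measure (Gqs L v ⧸ Subgroup.center (Gqs L v))) [μZ.IsHaarMeasure] [μZ'.IsHaarMeasure]
    {π2 πn π2' πn' : IrrClass (Gqs L v)}
    (hKL : KeysCaseTwoLabels L v (μω.semilocalComponent L v) (torusLocalComponent L (IsCMField.complexConj L) v ξ.η)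
      (torusLocalComponent L (IsCMField.complexConj L) v ξ.ψ) π2 πn)
    (hKL' : KeysCaseTwoLabels L v (μω.semilocalComponent L v) (torusLocalComponent L (IsCMField.complexConj L) v ξ.η)
      (torusLocalComponent L (IsCMField.complexConj L) v ξ.ψ) π2' πn')
    (hn : ¬ πn.IsSquareIntegrable μZ) (hn' : ¬ πn'.IsSquareIntegrable μZ') :
    IrrClass.comap (cmDatumLocalCongr L v T ha h).symm πn = IrrClass.comap (cmDatumLocalCongr L v T' ha' h').symm πn' := by
  obtain ⟨-, rfl⟩ := keysLabelsCM_unique_of_isHaarMeasure μω hμω ξ hns μZ μZ' hKL hKL' hn hn'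
  obtain ⟨u, hu⟩ := UnitaryGroup.exists_cmDatumLocalCongr_eq_apply_conj L (N := 3) ⟨1, rfl⟩ hH v T T' ha ha' h h'
  exact IrrClass.comap_symm_eq_comap_symm_of_forall_eq_conj (cmDatumLocalCongr L v T ha h) (cmDatumLocalCongr L v T' ha' h')
    (cmDatumLocalCongr L v T ha h u) (fun g => by rw [hu g, map_mul, map_mul, map_inv]) πn'

set_option synthInstance.maxHeartbeats 400000 in
set_option maxHeartbeats 1600000 in
/-- **Companion for `π²(ξ_v) ∘ e`**: the transported square-integrable label is intrinsic too. [cite: Rogawski1990, §12.2 (2) pp. 173–174; §14.2 p. 234]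
[cite: BushnellHenniart2006, §1.1] -/
theorem comap_keysLabelCM_sq_eq (hH : (H.map (cmConjRingHom L))ᵀ = H) (μω : HeckeCharacter L)
    (hμω : ∀ x : Literature.NumberTheory.GaloisRepresentations.ideleGroup ↥(maximalRealSubfield L), μω (AdeleRing.ideleBaseChange ↥(maximalRealSubfield L) L x) = quadraticHeckeCharCM L x)
    (ξ : OneDimAutRepH L) {v : HeightOneSpectrum (𝓞 ↥(maximalRealSubfield L))}
    (hns : ∀ w : PlacesOver L v, IsCMField.complexConj L • w.1 = w.1)
    (T T' : GL (Fin 3) (LocalRing L v)) {a a' : LocalRing L v} (ha : IsUnit a) (ha' : IsUnit a')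
    (h : formCongr (conjLocal L (IsCMField.complexConj L) v) T (H.map (algebraMap L (LocalRing L v))) =
      a • (Matrix.of fun i j : Fin 3 => if i.val + j.val + 1 = 3 then (1 : L) else 0).map (algebraMap L (LocalRing L v)))
    (h' : formCongr (conjLocal L (IsCMField.complexConj L) v) T' (H.map (algebraMap L (LocalRing L v))) =
      a' • (Matrix.of fun i j : Fin 3 => if i.val + j.val + 1 = 3 then (1 : L) else 0).map (algebraMap L (LocalRing L v)))
    [MeasurableSpace (Gqs L v ⧸ Subgroup.center (Gqs L v))] [BorelSpace (Gqs L v ⧸ Subgroup.center (Gqs L v))]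
    (μZ μZ' : Measure (Gqs L v ⧸ Subgroup.center (Gqs L v))) [μZ.IsHaarMeasure] [μZ'.IsHaarMeasure]
    {π2 πn π2' πn' : IrrClass (Gqs L v)}
    (hKL : KeysCaseTwoLabels L v (μω.semilocalComponent L v) (torusLocalComponent L (IsCMField.complexConj L) v ξ.η)
      (torusLocalComponent L (IsCMField.complexConj L) v ξ.ψ) π2 πn)
    (hKL' : KeysCaseTwoLabels L v (μω.semilocalComponent L v) (torusLocalComponent L (IsCMField.complexConj L) v ξ.η)
      (torusLocalComponent L (IsCMField.complexConj L) v ξ.ψ) π2' πn')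
    (hn : ¬ πn.IsSquareIntegrable μZ) (hn' : ¬ πn'.IsSquareIntegrable μZ') :
    IrrClass.comap (cmDatumLocalCongr L v T ha h).symm π2 = IrrClass.comap (cmDatumLocalCongr L v T' ha' h').symm π2' := by
  obtain ⟨rfl, -⟩ := keysLabelsCM_unique_of_isHaarMeasure μω hμω ξ hns μZ μZ' hKL hKL' hn hn'
  obtain ⟨u, hu⟩ := UnitaryGroup.exists_cmDatumLocalCongr_eq_apply_conj L (N := 3) ⟨1, rfl⟩ hH v T T' ha ha' h h'
  exact IrrClass.comap_symm_eq_comap_symm_of_forall_eq_conj (cmDatumLocalCongr L v T ha h) (cmDatumLocalCongr L v T' ha' h')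
    (cmDatumLocalCongr L v T ha h u) (fun g => by rw [hu g, map_mul, map_mul, map_inv]) π2'

end Transport

end Summit.HodgeConjecture.HodgeConjecture.Cruxes.H413.F0P3cDbTKeysLabelRigidity

end
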